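import Summits.BirchSwinnertonDyer.Rank1Residual.Additive.QuadraticBranchOddStrictExactControlDischarge
import Summits.BirchSwinnertonDyer.Rank1Residual.Additive.StrictSelmerIndex
import HarnessLib

/-!
# THE LOWER HALF WITHOUT KITAJIMA–OTSUKI: `(C1_η) ∧ (C2_η-GZ) ⟹ ord_p #Ш(W)_an ≤ ord_p #Ш(W)`
# (`MissingLowerBoundAt W p`, the predicate of the class target `LowerHalfOnType`) from `hPT`, GZK,
# Gross–Zagier, modularity and the LOWER INCLUSION of the odd main conjecture at `η` ONLY — no (R2),
# no `hKO`, no `hnf`, and only one inclusion of Kobayashi's Thm. 7.4 reading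
# (cell `b2b-bsdres`, CLASS-CLOSURE lane, class O10 — x1b GEN 44, class lead; file 126 of the series)

HONEST FRAMING (cell `b2b-bsdres`, run/shared/lean/b2b/bsd-rank1-residual/, verbatim in every
file): the goal of the cell is to DELETE the COMBINATION-SHAPED residual classes of the
Birch–Swinnerton-Dyer formula for ALL analytic-rank `≤ 1` elliptic curves over `ℚ` — "full BSD
formula for every rank `≤ 1` curve in class `C`" assembled STRICTLY from published theorems — so
that the rank-`≤ 1` remainder becomes exactly the CONSTRUCTION-SHAPED classes, which are TYPED
(missing-input `Prop`s), NOT attempted. This is not "finishing BSD". Prove what is provable now;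
shrink each hard class to its core with data; no claim beyond stated classes. Tool theorems only:
no definition, no Literature fact, no `_holds` of a conjecture, no `sorry`, axioms standard.
CONDITIONAL on every displayed hypothesis; (C1_η) and (C2_η-GZ) are CONJECTURES (typed), appearing
only as HYPOTHESES; nothing is booked; no mark / label moves; the classes served stay OPEN.

## What is proved

The O10 class target is the LOWER half `MissingLowerBoundAt W p` : `ord_p #Ш(W)_an ≤ ord_p #Ш(W)`
(`X12/ClassClosureO10RubinEta.lean`, `LowerHalfOnType`; the upper half is a theorem of the
published record on the core). File 124 obtained the full `BSDp W p` from (C1_η) ∧ (C2_η-GZ) using,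
on the Selmer side, the EXACT count of file 122 — and that exactness is the ONE place where the
Kitajima–Otsuki input (R2)/`hKO` (`X^{−,str}[T] = 0`) enters (file 121:
`p^{ord_p f(0)} · #X[T] = #Ш[p^∞] · p^{2ν} · ∏_T p^{ord_p c_ℓ}`). For the LOWER half the finite
defect group `X[T]` is on the harmless side: file 121's `hnf`-FREE divisibility
`p^{ord_p f(0)} ∣ #Ш[p^∞] · p^{2ν} · ∏_T p^{ord_p c_ℓ}` suffices. Hence:

* §1 `valuation_coeff_one_le_of_lowerReading` — the ONE-SIDED (C3_η): under `hPT`, GZK and the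
  LOWER odd-`η` reading `h74l` ((C1_η) at the twin ⟹ `char X^{−,str}(W/ℚ_∞) ⊆ (L')`, `L_p⁻ = X·L'` —
  the inclusion NOT supplied by Kato's Euler system: Kobayashi's Thm. 4.1 gives the other one,
  `(X⁻¹L_p⁻) ⊆ char`, and Thm. 7.4 the equality under (C1_η)), at a pair carrying the data of the
  typed statement: `Sel_str(W/ℚ)[p^∞]` is finite and
  `v_p(coeff₁ L) ≤ ord_p #Sel_str + n + ord_p(Tam(W)/#W(ℚ)_tors²)`. NO no-finite-submodule input,
  NO `coeff₁ L ≠ 0` input (a theorem in rank one).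
* §2 `missingLowerBoundAt_of_plusMC_of_pAdicGrossZagierValuation_of_lowerReading` — with (C2_η-GZ)
  (`QuadraticBranchMinusLeadingValuationAt W p 0`: `v_p(coeff₁ L) = 2n + ord_p(#Ш_an·Tam/#tors²)`),
  Gross–Zagier `hGZ` + modularity `hmod` (`#Ш_an ∈ ℚ^×`) and gen 30's index
  `ord_p #Sel_str = n + ord_p #Ш[p^∞]`: `ord_p #Ш(W)_an ≤ ord_p #Ш(W)`, i.e. `MissingLowerBoundAt W p`;
  also the `BSDp`-shaped lower half (`rank = r_an`, `Ш(p)` finite, the inequality); §3 the same from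
  the EXACT reading `h74x` of files 123/124.
NET for the class: the inputs of the O10-PS ∩ `e = 2` LOWER half are EXACTLY (C1_η) (through the lower
inclusion of the odd main conjecture at `η`) + (C2_η-GZ) + the named facts `hPT`, GZK, `hGZ`, `hmod`;
the Kitajima–Otsuki theorem and the Kato-side inclusion are needed only for the (already known) upper
half / the exact formula. Nothing booked.

References: [Kobayashi2003] §4 (p. 8: odd main conjecture at `η ≠ 1`, `Char X⁻(E/K_∞)^η = (X⁻¹L_p⁻(E,η,X))`),
Thm. 7.4 (p. 13), Thm. 9.3 (p. 26); [GreenbergLNM1716] §4 Lemma 4.2 (p. 102); [Miller2011LMS] §1,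
Def. 1.1; [GrossZagier1986] Thm. I.(7.3); [MilneADT2006] I Thm. 4.10.
-/

noncomputable section

open scoped Classical MatrixGroups ModularForm

open CongruenceSubgroup Field Function NumberField IsDedekindDomain WeierstrassCurve
open Literature.NumberTheory.EllipticCurves
open Literature.NumberTheory.EllipticCurves.ModularForms
open Literature.NumberTheory.EllipticCurves.Kobayashi2003
open Literature.NumberTheory.EllipticCurves.Rank1Residual
open Literature.NumberTheory.EllipticCurves.Rank1Residual.Typed
open Literature.NumberTheory.GaloisRepresentations
open Literature.NumberTheory.GaloisCohomology
open Literature.NumberTheory.EllipticCurves.IwasawaAlgebra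

-- Over `ℚ` two `ℚ`-algebra structures on a completion are in scope; the general-`K` statements must be
-- met by the completion's own (the device of files 78, 107, 108, 118, 120–123).
attribute [local instance 10000] IsDedekindDomain.HeightOneSpectrum.instAlgebraAdicCompletion
  NumberField.Place.instAlgebraCompletion

namespace Summit.BirchSwinnertonDyer.Rank1Residual.Additive.LevelBridge

variable (W : WeierstrassCurve ℚ) [W.IsElliptic] [W.IsGloballyMinimal] (p : ℕ) [hp : Fact p.Prime]
  {V : WeierstrassCurve ℚ} [V.IsElliptic] [V.IsGloballyMinimal] {C : VariableChange ℚ}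
  {N : ℕ} [NeZero N] {f : CuspForm (Gamma0 N) 2} {ϖ : ℚ} {L : IwasawaAlgebra p}
  {P : W.toAffine.Point} {n : ℕ}

/-! ## §1 The one-sided (C3_η) without any no-finite-submodule input -/

/-- **ONE-SIDED (C3_η) WITHOUT KITAJIMA–OTSUKI: `Sel_str(W/ℚ)[p^∞]` finite and
`v_p(coeff₁ L) ≤ ord_p #Sel_str(W/ℚ)[p^∞] + n + ord_p(Tam(W)/#W(ℚ)_tors²)`.** For the globally minimal
`(−1)^{(p−1)/2}p`-twist pair (`C • W^{(p*)} = V`, `V` good at `p ≥ 5`, `a_p(V) = 0`, newform `f`, period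
ratio `ϖ`, `L` with the interpolation property of `L_p⁻(V, η, X)`, `W(ℚ_p)[p] = 0`, a generator `P` of
`W(ℚ)` modulo torsion of exact level `n` in `W(ℚ_p)`; NO `coeff₁ L ≠ 0` hypothesis — in rank one
`g(0) ≠ 0` for the characteristic power series is a THEOREM of file 118), of analytic rank one, GIVEN
`hPT`, GZK (`Ш(W)` finite) and the LOWER odd-`η` reading `h74l` ((C1_η) at the twin ⟹
`char X^{−,str}(W/ℚ_∞) ⊆ (L')` for `L = X·L'`, i.e. `L' ∣ g`; hypothesis TEXT in the (R3) frame with the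
inclusion OPPOSITE to Kato's; NOTHING asserted). Proof: as file 123 §1, with file 121's `hnf`-FREE
divisibility `p^{ord_p g(0)} ∣ #Ш[p^∞]·p^{2n}·∏_T p^{ord_p c_ℓ}` in place of the exact count — so NO
(R2)/`hKO` — and `v_p(L'(0)) ≤ v_p(g(0))` from `L' ∣ g`; gen 30's index; §0 of file 123
(`∑_T ord_p c_ℓ = ord_p Tam(W)`, `p ∤ #W(ℚ)_tors`). CONDITIONAL on the three displayed hypotheses;
(C1_η) is a hypothesis; nothing about (C2_η-GZ) or `BSD(W, p)` claimed; nothing booked. [cite: Kobayashi2003, §4 (p. 8), Thm. 7.4 (p. 13), Thm. 9.3 (p. 26)]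
[cite: GreenbergLNM1716, §4 Lemma 4.2 (p. 102)] [cite: MilneADT2006, Ch. I, Thm. 4.10]
[cite: SilvermanAEC2009, Thm. VII.6.1 and Prop. VII.6.3] -/
theorem valuation_coeff_one_le_of_lowerReading
    (hPT : poitouTate_selmerStructure_duality_real ℚ)
    (hGZK : rank_eq_analyticRank_of_analyticRank_le_one)
    (h74l : ∀ (V : WeierstrassCurve ℚ) [V.IsElliptic] [V.IsGloballyMinimal] (C : VariableChange ℚ)
        {N : ℕ} [NeZero N] {f : CuspForm (Gamma0 N) 2},
        p ≠ 2 → C • W.quadraticTwist ((-1) ^ (p / 2) * p) = V →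
        V.HasGoodReductionAtPrime p → V.frobeniusTrace p = 0 →
        QuadraticBranchPlusMainConjectureAt V p → IsNewformOf V f →
        ∀ (ϖ : ℚ), (if Even (p / 2) then (ϖ : ℝ) * V.realPeriodRat = plusPeriod f
            else (ϖ : ℝ) * V.imaginaryPeriodRat = minusPeriod f) →
        ∀ (Lη : IwasawaAlgebra p), IsQuadraticBranchMinusLFunction f p ϖ Lη →
        ∀ (κ : ZpExtension ℚ p) (γ : Field.absoluteGaloisGroup ℚ),
          κ.IsCyclotomic → κ.IsTopGenerator γ → IsCyclotomicVariable p γ →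
        ∀ (D : StrictSignedSelmerDualData W κ ℚ_[p] γ (-1)) (L' : IwasawaAlgebra p),
          Lη = PowerSeries.X * L' → D.charIdeal ≤ Ideal.span {L'})
    (hp5 : 5 ≤ p) (hCV : C • W.quadraticTwist ((-1) ^ (p / 2) * p) = V)
    (hgood : V.HasGoodReductionAtPrime p) (hap : V.frobeniusTrace p = 0)
    (h1 : QuadraticBranchPlusMainConjectureAt V p) (hf : IsNewformOf V f)
    (hϖ : if Even (p / 2) then (ϖ : ℝ) * V.realPeriodRat = plusPeriod f
        else (ϖ : ℝ) * V.imaginaryPeriodRat = minusPeriod f)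
    (hL : IsQuadraticBranchMinusLFunction f p ϖ L)
    (htors : ∀ Q : (W.baseChange ℚ_[p]).toAffine.Point, p • Q = 0 → Q = 0)
    (hP : ¬ IsOfFinAddOrder P)
    (hgen : ∀ R : W.toAffine.Point, ∃ (k : ℤ) (T : W.toAffine.Point),
      IsOfFinAddOrder T ∧ R = k • P + T)
    (hdiv : ∃ Q : (W.baseChange ℚ_[p]).toAffine.Point, p ^ n • Q = W.toPadicPoint p P)
    (hndiv : ∀ Q : (W.baseChange ℚ_[p]).toAffine.Point, p ^ (n + 1) • Q ≠ W.toPadicPoint p P)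
    (hr : W.analyticRank = 1) :
    Finite ↥(strictSelmerPInfty W p) ∧
      ((PowerSeries.coeff 1 L : ℤ_[p]) : ℚ_[p]).valuation ≤
        (padicValNat p (Nat.card ↥(strictSelmerPInfty W p)) : ℤ) + n +
          padicValRat p ((W.tamagawaProduct : ℚ) / (W.torsionOrder : ℚ) ^ 2) := by
  have hp2 : p ≠ 2 := by omega
  set v₀ := (Rat.HeightOneSpectrum.primesEquiv (R := 𝓞 ℚ)).symm ⟨p, hp.out⟩ with hv₀
  -- GZK: `Ш(W)` is finite
  obtain ⟨-, hfin⟩ := hGZK W hr.le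
  haveI : Finite W.sha := hfin
  haveI hSha : Finite (AddCommGroup.primaryComponent W.sha p) := inferInstance
  -- the cyclotomic `ℤ_p`-extension of `ℚ` and a normalised topological generator `γ`
  obtain ⟨γ, hγ, hχ⟩ := CyclotomicZp.exists_isTopGenerator_zpExtension p
  have hκ := CyclotomicZp.isCyclotomic_zpExtension p
  have hγc : IsCyclotomicVariable p γ := ⟨1, IsOfFinOrder.one, by rw [mul_one]; exact hχ⟩
  -- a strict-minus dual datum of `Sel^{−,str}(W/ℚ_∞)` at the model `ℚ_[p]`
  obtain ⟨D⟩ := nonempty_strictSignedSelmerDualData W (CyclotomicZp.zpExtension p) ℚ_[p] (-1) hγ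
  -- `L = X·L'`, `L'(0) = coeff₁ L`, and `char X^{−,str} ⊆ (L')` by the lower odd-`η` reading
  obtain ⟨L', hLL', hL'0⟩ := hL.exists_eq_X_mul
  have hle : D.charIdeal ≤ Ideal.span {L'} :=
    h74l V C hp2 hCV hgood hap h1 hf ϖ hϖ L hL _ γ hκ hγ hγc D L' hLL'
  -- a generator `g` of the characteristic ideal (`Λ` a UFD): `L' ∣ g`
  obtain ⟨g, hg⟩ := SubSelmerControlZero.exists_charIdeal_eq_span p D.X
  have hchar : D.charIdeal = Ideal.span {g} := by rw [StrictSignedSelmerDualData.charIdeal_def, hg]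
  have hL'g : L' ∣ g := Ideal.span_singleton_le_span_singleton.mp (hchar ▸ hle)
  -- the exceptional set `T`: the places `≠ v₀` off which `W` has good reduction
  obtain ⟨S, hS⟩ := exists_finset_forall_not_mem_good W p
  have hpT : v₀ ∉ S.erase v₀ := fun h ↦ (Finset.mem_erase.mp h).1 rfl
  have hTmem : ∀ v : HeightOneSpectrum (𝓞 ℚ), v ≠ v₀ →
      p ∣ (W.baseChange (v.adicCompletion ℚ)).localTamagawaNumber (v.adicCompletionIntegers ℚ) →
        v ∈ S.erase v₀ := by
    intro v hv hdvd
    refine Finset.mem_erase.mpr ⟨hv, ?_⟩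
    by_contra hvS
    rw [W.localTamagawaNumber_eq_one_of_hasGoodReductionAt_holds v (hS v hvS).2] at hdvd
    exact hp.out.one_lt.ne' (Nat.dvd_one.mp hdvd)
  -- `g(0) ≠ 0` in rank one (file 118), hence `v_p(L'(0)) ≤ v_p(g(0))`
  have hg0 : PowerSeries.constantCoeff g ≠ 0 := by
    obtain ⟨Q, hPQ⟩ := hdiv
    exact ((isTorsion_and_constantCoeff_ne_zero_of_quadraticTwist_signedPrime_rankOne W (CyclotomicZp.zpExtension p)
      hp2 hκ C V hCV hgood hap hPT P hP hgen hPQ hndiv (S.erase v₀) hpT hTmem hγ D).2.2 g hchar).2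
  have hL'le : ((PowerSeries.constantCoeff L' : ℤ_[p]) : ℚ_[p]).valuation ≤
      ((PowerSeries.constantCoeff g : ℤ_[p]) : ℚ_[p]).valuation := by
    obtain ⟨k, hk⟩ := hL'g
    have hgk : PowerSeries.constantCoeff g = PowerSeries.constantCoeff L' * PowerSeries.constantCoeff k := by
      rw [hk, map_mul]
    have hL'0' : PowerSeries.constantCoeff L' ≠ 0 := fun h ↦ hg0 (by rw [hgk, h, zero_mul])
    have hk0 : PowerSeries.constantCoeff k ≠ 0 := fun h ↦ hg0 (by rw [hgk, h, mul_zero])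
    have hL'Q : ((PowerSeries.constantCoeff L' : ℤ_[p]) : ℚ_[p]) ≠ 0 := PadicInt.coe_ne_zero.mpr hL'0'
    have hkQ : ((PowerSeries.constantCoeff k : ℤ_[p]) : ℚ_[p]) ≠ 0 := PadicInt.coe_ne_zero.mpr hk0
    rw [hgk, PadicInt.coe_mul, Padic.valuation_mul hL'Q hkQ]
    exact le_add_of_nonneg_right PadicInt.valuation_coe_nonneg
  -- the `hnf`-FREE Selmer side (file 121): `p^{ord_p g(0)} ∣ #Ш[p^∞] · (p^{2n} · ∏_T p^{ord_p c_ℓ})`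
  have hSel := pow_constantCoeff_dvd_card_sha_mul_of_quadraticTwist_signedPrime_rankOne W
    (CyclotomicZp.zpExtension p) hp2 hκ C V hCV hgood hap hPT P hP hgen hdiv hndiv (S.erase v₀) hpT hTmem hγ D
    hchar
  -- gen 30's index: `#Sel_str(W/ℚ)[p^∞] = p^n · #Ш[p^∞]`
  have hidx := StrictSha.strictSelmerIndexAt_holds W p P n hP hgen htors hdiv hndiv
  -- §0 bookkeeping (file 123)
  have hv0 := padicValNat_localTamagawaNumber_eq_zero_of_quadraticTwist_signedPrime W p hp5 C V hCV hgood
  have hTamSum := sum_padicValNat_localTamagawaNumber_eq_padicValNat_tamagawaProduct W p (S.erase v₀) hpT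
    hTmem hv0
  have htors0 := padicValNat_torsionOrder_eq_zero_of_noPTorsion W p htors
  -- numerics
  have hSha0 : Nat.card (AddCommGroup.primaryComponent W.sha p) ≠ 0 := Nat.card_pos.ne'
  have hp0 : p ≠ 0 := hp.out.ne_zero
  rw [Finset.prod_pow_eq_pow_sum, ← pow_add, hTamSum] at hSel
  -- `ord_p g(0) ≤ ord_p #Ш[p^∞] + (2n + ord_p Tam(W))`
  have hval : (((PowerSeries.constantCoeff g : ℤ_[p]) : ℚ_[p]).valuation).toNat ≤
      padicValNat p (Nat.card (AddCommGroup.primaryComponent W.sha p)) + (2 * n + padicValNat p W.tamagawaProduct) := by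
    have h := (padicValNat_dvd_iff_le (mul_ne_zero hSha0 (pow_ne_zero _ hp0))).mp hSel
    rwa [padicValNat.mul hSha0 (pow_ne_zero _ hp0), padicValNat.prime_pow] at h
  have hidxval : padicValNat p (Nat.card ↥(strictSelmerPInfty W p)) =
      n + padicValNat p (Nat.card (AddCommGroup.primaryComponent W.sha p)) := by
    rw [hidx, padicValNat.mul (pow_ne_zero _ hp0) hSha0, padicValNat.prime_pow]
  refine ⟨Nat.finite_of_card_ne_zero (by rw [hidx]; exact mul_ne_zero (pow_ne_zero _ hp0) hSha0), ?_⟩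
  -- `ord_p(Tam/#tors²) = ord_p Tam`
  have hTamQ : (W.tamagawaProduct : ℚ) ≠ 0 := by exact_mod_cast W.tamagawaProduct_pos_holds.ne'
  have htQ : (W.torsionOrder : ℚ) ≠ 0 := by exact_mod_cast W.torsionOrder_pos_holds.ne'
  have hrat : padicValRat p ((W.tamagawaProduct : ℚ) / (W.torsionOrder : ℚ) ^ 2) =
      (padicValNat p W.tamagawaProduct : ℤ) := by
    rw [padicValRat.div hTamQ (pow_ne_zero 2 htQ), padicValRat.pow, padicValRat.of_nat, padicValRat.of_nat,
      htors0]
    simp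
  -- `v_p(coeff₁ L) = v_p(L'(0)) ≤ v_p(g(0)) = (v_p(g(0))).toNat`
  have hv' : ((PowerSeries.constantCoeff g : ℤ_[p]) : ℚ_[p]).valuation =
      ((((PowerSeries.constantCoeff g : ℤ_[p]) : ℚ_[p]).valuation).toNat : ℤ) :=
    (Int.toNat_of_nonneg (PadicInt.valuation_coe_nonneg)).symm
  rw [← hL'0, hrat, hidxval]
  push_cast
  have hval' : ((((PowerSeries.constantCoeff g : ℤ_[p]) : ℚ_[p]).valuation).toNat : ℤ) ≤
      (padicValNat p (Nat.card (AddCommGroup.primaryComponent W.sha p)) : ℤ) +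
        (2 * (n : ℤ) + (padicValNat p W.tamagawaProduct : ℤ)) := by exact_mod_cast hval
  rw [hv'] at hL'le
  linarith

/-! ## §2 The LOWER half of `BSD(W, p)` from (C1_η) ∧ (C2_η-GZ) — no Kitajima–Otsuki input -/

/-- **(C1_η) ∧ (C2_η-GZ) ⟹ `ord_p #Ш(W)_an ≤ ord_p #Ш(W)` (`MissingLowerBoundAt W p`, the predicate of
the class target `LowerHalfOnType`) in analytic rank one, given `hmod`, `hGZ`, `hGZK`, `hPT` and the
LOWER odd-`η` reading `h74l` — WITHOUT the Kitajima–Otsuki input.** Arithmetic: §1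
`v ≤ ord_p #Sel_str + n + ord_p(Tam/#tors²)`; gen 30's index `ord_p #Sel_str = n + ord_p #Ш(p)`;
(C2_η-GZ) `v = 2n + ord_p(#Ш_an · Tam/#tors²)` with `#Ш_an ∈ ℚ^×` (`hGZ`, `hmod`); hence
`ord_p #Ш_an ≤ ord_p #Ш(p) = ord_p #Ш` (`Ш` finite by GZK). CONDITIONAL on every displayed hypothesis;
(C1_η) and (C2_η-GZ) are CONJECTURES (typed), NOT claimed; nothing booked; the classes served stay OPEN;
no mark moves (a mark moves only on the director's countersign of a referee reading).
[cite: Miller2011LMS, §1 and Def. 1.1] [cite: Kobayashi2003, §4 (p. 8), Thm. 7.4 (p. 13), Thm. 9.3 (p. 26)]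
[cite: GrossZagier1986, Thm. I.(7.3) 2) (p. 231)] [cite: Darmon2004, Thm. 3.22] -/
theorem missingLowerBoundAt_of_plusMC_of_pAdicGrossZagierValuation_of_lowerReading
    (hmod : hasEntireLFunction_rat) (hGZ : GrossZagier1986_thm_I_7_3)
    (hGZK : rank_eq_analyticRank_of_analyticRank_le_one)
    (hPT : poitouTate_selmerStructure_duality_real ℚ)
    (h74l : ∀ (V : WeierstrassCurve ℚ) [V.IsElliptic] [V.IsGloballyMinimal] (C : VariableChange ℚ)
        {N : ℕ} [NeZero N] {f : CuspForm (Gamma0 N) 2},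
        p ≠ 2 → C • W.quadraticTwist ((-1) ^ (p / 2) * p) = V →
        V.HasGoodReductionAtPrime p → V.frobeniusTrace p = 0 →
        QuadraticBranchPlusMainConjectureAt V p → IsNewformOf V f →
        ∀ (ϖ : ℚ), (if Even (p / 2) then (ϖ : ℝ) * V.realPeriodRat = plusPeriod f
            else (ϖ : ℝ) * V.imaginaryPeriodRat = minusPeriod f) →
        ∀ (Lη : IwasawaAlgebra p), IsQuadraticBranchMinusLFunction f p ϖ Lη →
        ∀ (κ : ZpExtension ℚ p) (γ : Field.absoluteGaloisGroup ℚ),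
          κ.IsCyclotomic → κ.IsTopGenerator γ → IsCyclotomicVariable p γ →
        ∀ (D : StrictSignedSelmerDualData W κ ℚ_[p] γ (-1)) (L' : IwasawaAlgebra p),
          Lη = PowerSeries.X * L' → D.charIdeal ≤ Ideal.span {L'})
    (h2 : QuadraticBranchMinusLeadingValuationAt W p 0)
    (hp5 : 5 ≤ p) (hCV : C • W.quadraticTwist ((-1) ^ (p / 2) * p) = V)
    (hgood : V.HasGoodReductionAtPrime p) (hap : V.frobeniusTrace p = 0)
    (h1 : QuadraticBranchPlusMainConjectureAt V p) (hf : IsNewformOf V f)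
    (hϖ : if Even (p / 2) then (ϖ : ℝ) * V.realPeriodRat = plusPeriod f
        else (ϖ : ℝ) * V.imaginaryPeriodRat = minusPeriod f)
    (hL : IsQuadraticBranchMinusLFunction f p ϖ L)
    (htors : ∀ Q : (W.baseChange ℚ_[p]).toAffine.Point, p • Q = 0 → Q = 0)
    (hP : ¬ IsOfFinAddOrder P)
    (hgen : ∀ R : W.toAffine.Point, ∃ (k : ℤ) (T : W.toAffine.Point),
      IsOfFinAddOrder T ∧ R = k • P + T)
    (hdiv : ∃ Q : (W.baseChange ℚ_[p]).toAffine.Point, p ^ n • Q = W.toPadicPoint p P)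
    (hndiv : ∀ Q : (W.baseChange ℚ_[p]).toAffine.Point, p ^ (n + 1) • Q ≠ W.toPadicPoint p P)
    (hr : W.analyticRank = 1) : MissingLowerBoundAt W p := by
  obtain ⟨-, hfin⟩ := hGZK W hr.le
  haveI : Finite W.sha := hfin
  -- `#Ш_an ∈ ℚ^×`
  obtain ⟨s, hs⟩ := Disegni2020.exists_rat_shaAn_eq_of_analyticRank_eq_one hGZ hGZK W hr
  have hs0 : s ≠ 0 := by
    rintro rfl
    exact AdditivePotMult.shaAn_ne_zero W hmod (by rw [hs, Rat.cast_zero])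
  have hc : (W.tamagawaProduct : ℚ) ≠ 0 := by exact_mod_cast W.tamagawaProduct_pos_holds.ne'
  have ht : (W.torsionOrder : ℚ) ≠ 0 := by exact_mod_cast W.torsionOrder_pos_holds.ne'
  have hct : (W.tamagawaProduct : ℚ) / (W.torsionOrder : ℚ) ^ 2 ≠ 0 :=
    div_ne_zero hc (pow_ne_zero 2 ht)
  -- (C2_η-GZ): `coeff₁ L ≠ 0` and `v = 2n + ord_p(s · Tam/#tors²)`
  obtain ⟨-, hv2⟩ := h2 V C hp5 hCV hgood hap hr hf ϖ hϖ L hL htors P n hP hgen hdiv hndiv s hs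
  have hsplit : padicValRat p (s * W.tamagawaProduct / (W.torsionOrder : ℚ) ^ 2) =
      padicValRat p s + padicValRat p ((W.tamagawaProduct : ℚ) / (W.torsionOrder : ℚ) ^ 2) := by
    rw [mul_div_assoc, padicValRat.mul hs0 hct]
  -- §1: `v ≤ ord_p #Sel_str + n + ord_p(Tam/#tors²)`
  obtain ⟨-, hv3⟩ := valuation_coeff_one_le_of_lowerReading W p hPT hGZK h74l hp5 hCV hgood hap h1 hf hϖ hL
    htors hP hgen hdiv hndiv hr
  -- the index: `ord_p #Sel_str = n + ord_p #Ш(p)`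
  haveI : Finite (AddCommGroup.primaryComponent W.sha p) := inferInstance
  have hI := (StrictSha.strictSelmerIndexAt_holds W p).padicValNat_card_eq hP hgen htors hdiv hndiv
  refine ⟨s, hs, ?_⟩
  rw [WeierstrassCurve.shaOrder, ← padicValNat_card_addPrimaryComponent]
  rw [hI, Nat.cast_add] at hv3
  rw [hsplit, add_zero] at hv2
  linarith

/-- … and the **`BSDp`-shaped LOWER HALF**: `rank W(ℚ) = r_an(W)`, `Ш(W)(p)` finite, and `#Ш(W)_an` is a
rational `q` with `ord_p q ≤ ord_p #Ш(W)(p)` — from the same inputs (`h74l`; no Kitajima–Otsuki input).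
CONDITIONAL on every displayed hypothesis; (C1_η), (C2_η-GZ) NOT claimed; nothing booked.
[cite: Miller2011LMS, §1 and Def. 1.1] [cite: Darmon2004, Thm. 3.22] -/
theorem lowerHalf_of_plusMC_of_pAdicGrossZagierValuation_of_lowerReading
    (hmod : hasEntireLFunction_rat) (hGZ : GrossZagier1986_thm_I_7_3)
    (hGZK : rank_eq_analyticRank_of_analyticRank_le_one)
    (hPT : poitouTate_selmerStructure_duality_real ℚ)
    (h74l : ∀ (V : WeierstrassCurve ℚ) [V.IsElliptic] [V.IsGloballyMinimal] (C : VariableChange ℚ)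
        {N : ℕ} [NeZero N] {f : CuspForm (Gamma0 N) 2},
        p ≠ 2 → C • W.quadraticTwist ((-1) ^ (p / 2) * p) = V →
        V.HasGoodReductionAtPrime p → V.frobeniusTrace p = 0 →
        QuadraticBranchPlusMainConjectureAt V p → IsNewformOf V f →
        ∀ (ϖ : ℚ), (if Even (p / 2) then (ϖ : ℝ) * V.realPeriodRat = plusPeriod f
            else (ϖ : ℝ) * V.imaginaryPeriodRat = minusPeriod f) →
        ∀ (Lη : IwasawaAlgebra p), IsQuadraticBranchMinusLFunction f p ϖ Lη →
        ∀ (κ : ZpExtension ℚ p) (γ : Field.absoluteGaloisGroup ℚ),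
          κ.IsCyclotomic → κ.IsTopGenerator γ → IsCyclotomicVariable p γ →
        ∀ (D : StrictSignedSelmerDualData W κ ℚ_[p] γ (-1)) (L' : IwasawaAlgebra p),
          Lη = PowerSeries.X * L' → D.charIdeal ≤ Ideal.span {L'})
    (h2 : QuadraticBranchMinusLeadingValuationAt W p 0)
    (hp5 : 5 ≤ p) (hCV : C • W.quadraticTwist ((-1) ^ (p / 2) * p) = V)
    (hgood : V.HasGoodReductionAtPrime p) (hap : V.frobeniusTrace p = 0)
    (h1 : QuadraticBranchPlusMainConjectureAt V p) (hf : IsNewformOf V f)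
    (hϖ : if Even (p / 2) then (ϖ : ℝ) * V.realPeriodRat = plusPeriod f
        else (ϖ : ℝ) * V.imaginaryPeriodRat = minusPeriod f)
    (hL : IsQuadraticBranchMinusLFunction f p ϖ L)
    (htors : ∀ Q : (W.baseChange ℚ_[p]).toAffine.Point, p • Q = 0 → Q = 0)
    (hP : ¬ IsOfFinAddOrder P)
    (hgen : ∀ R : W.toAffine.Point, ∃ (k : ℤ) (T : W.toAffine.Point),
      IsOfFinAddOrder T ∧ R = k • P + T)
    (hdiv : ∃ Q : (W.baseChange ℚ_[p]).toAffine.Point, p ^ n • Q = W.toPadicPoint p P)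
    (hndiv : ∀ Q : (W.baseChange ℚ_[p]).toAffine.Point, p ^ (n + 1) • Q ≠ W.toPadicPoint p P)
    (hr : W.analyticRank = 1) :
    W.mordellWeilRank = W.analyticRank ∧ Finite (AddCommGroup.primaryComponent W.sha p) ∧
      ∃ q : ℚ, shaAn W = (q : ℂ) ∧
        padicValRat p q ≤ padicValNat p (Nat.card (AddCommGroup.primaryComponent W.sha p)) := by
  obtain ⟨hrank, hfin⟩ := hGZK W hr.le
  haveI : Finite W.sha := hfin
  obtain ⟨q, hq, hle⟩ := missingLowerBoundAt_of_plusMC_of_pAdicGrossZagierValuation_of_lowerReading W p hmod hGZ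
    hGZK hPT h74l h2 hp5 hCV hgood hap h1 hf hϖ hL htors hP hgen hdiv hndiv hr
  refine ⟨hrank, inferInstance, q, hq, ?_⟩
  rwa [padicValNat_card_addPrimaryComponent, ← WeierstrassCurve.shaOrder]

/-! ## §3 The same from the EXACT reading `h74x` (file 123's hypothesis) -/

/-- **(C1_η) ∧ (C2_η-GZ) ⟹ `MissingLowerBoundAt W p` from the EXACT Kobayashi-7.4 reading `h74x`** (the
hypothesis text of files 123/124: `char X^{−,str}(W/ℚ_∞) = (L')`), by weakening it to the lower
inclusion. CONDITIONAL on every displayed hypothesis; (C1_η), (C2_η-GZ) NOT claimed; nothing booked.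
[cite: Kobayashi2003, §4 (p. 8), Thm. 7.4 (p. 13)] [cite: Miller2011LMS, §1 and Def. 1.1] -/
theorem missingLowerBoundAt_of_plusMC_of_pAdicGrossZagierValuation_of_readings
    (hmod : hasEntireLFunction_rat) (hGZ : GrossZagier1986_thm_I_7_3)
    (hGZK : rank_eq_analyticRank_of_analyticRank_le_one)
    (hPT : poitouTate_selmerStructure_duality_real ℚ)
    (h74x : ∀ (V : WeierstrassCurve ℚ) [V.IsElliptic] [V.IsGloballyMinimal] (C : VariableChange ℚ)
        {N : ℕ} [NeZero N] {f : CuspForm (Gamma0 N) 2},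
        p ≠ 2 → C • W.quadraticTwist ((-1) ^ (p / 2) * p) = V →
        V.HasGoodReductionAtPrime p → V.frobeniusTrace p = 0 →
        QuadraticBranchPlusMainConjectureAt V p → IsNewformOf V f →
        ∀ (ϖ : ℚ), (if Even (p / 2) then (ϖ : ℝ) * V.realPeriodRat = plusPeriod f
            else (ϖ : ℝ) * V.imaginaryPeriodRat = minusPeriod f) →
        ∀ (Lη : IwasawaAlgebra p), IsQuadraticBranchMinusLFunction f p ϖ Lη →
        ∀ (κ : ZpExtension ℚ p) (γ : Field.absoluteGaloisGroup ℚ),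
          κ.IsCyclotomic → κ.IsTopGenerator γ → IsCyclotomicVariable p γ →
        ∀ (D : StrictSignedSelmerDualData W κ ℚ_[p] γ (-1)) (L' : IwasawaAlgebra p),
          Lη = PowerSeries.X * L' → D.charIdeal = Ideal.span {L'})
    (h2 : QuadraticBranchMinusLeadingValuationAt W p 0)
    (hp5 : 5 ≤ p) (hCV : C • W.quadraticTwist ((-1) ^ (p / 2) * p) = V)
    (hgood : V.HasGoodReductionAtPrime p) (hap : V.frobeniusTrace p = 0)
    (h1 : QuadraticBranchPlusMainConjectureAt V p) (hf : IsNewformOf V f)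
    (hϖ : if Even (p / 2) then (ϖ : ℝ) * V.realPeriodRat = plusPeriod f
        else (ϖ : ℝ) * V.imaginaryPeriodRat = minusPeriod f)
    (hL : IsQuadraticBranchMinusLFunction f p ϖ L)
    (htors : ∀ Q : (W.baseChange ℚ_[p]).toAffine.Point, p • Q = 0 → Q = 0)
    (hP : ¬ IsOfFinAddOrder P)
    (hgen : ∀ R : W.toAffine.Point, ∃ (k : ℤ) (T : W.toAffine.Point),
      IsOfFinAddOrder T ∧ R = k • P + T)
    (hdiv : ∃ Q : (W.baseChange ℚ_[p]).toAffine.Point, p ^ n • Q = W.toPadicPoint p P)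
    (hndiv : ∀ Q : (W.baseChange ℚ_[p]).toAffine.Point, p ^ (n + 1) • Q ≠ W.toPadicPoint p P)
    (hr : W.analyticRank = 1) : MissingLowerBoundAt W p :=
  missingLowerBoundAt_of_plusMC_of_pAdicGrossZagierValuation_of_lowerReading W p hmod hGZ hGZK hPT
    (fun V _ _ C _ _ _ hp2 hCV hgood hap h1 hf ϖ hϖ Lη hLη κ γ hκ hγ hγc D L' hLL' ↦
      (h74x V C hp2 hCV hgood hap h1 hf ϖ hϖ Lη hLη κ γ hκ hγ hγc D L' hLL').le)
    h2 hp5 hCV hgood hap h1 hf hϖ hL htors hP hgen hdiv hndiv hr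

end Summit.BirchSwinnertonDyer.Rank1Residual.Additive.LevelBridge

end
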